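import Mathlib
import HarnessLib
import Literature.NumberTheory.Automorphic.BaseChangeArchimedeanDescent
import Literature.NumberTheory.Automorphic.TunnellOctahedralGlobal

/-!
# `ReciprocityTRCM` (route BaseFieldAscent, crux stmt-Langlands-1093), line `pieces`:
# registered stub `stub_quadraticDescentLAlgebraic` — L-algebraic quadratic descent

Stub 5A1 of the lead's reshape of stub 5 (weak (B) over totally real fields from reciprocity over
CM fields): a cuspidal L-algebraic `P` on `GL_n(𝔸_E)`, `[E : F] = 2`, whose Satake data are
`Gal(E/F)`-stable is the weak base change lift of an L-algebraic cuspidal `π` on `GL_n(𝔸_F)`.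

It is the conjunction of two named Literature facts and one seam:
* existence of the descended `π` — Arthur–Clozel, Ch. 3, Thm. 4.2 (d) in the Borel–Jacquet model,
  the tree's named fact `Literature.NumberTheory.Automorphic.cuspidal_descent_cyclic` (hypothesis);
* `L`-algebraicity of `π` — it descends along weak base change of prime degree by the archimedean
  clause of strong lifting (Arthur–Clozel Ch. 3 Thm. 5.1), the tree's theorem
  `ArthurClozel1989_strongLifting_archimedean.isLAlgebraic_descent'`, modulo that named fact and
  Clozel's existence of an infinity type of `π` (both hypotheses);
* `[E : F] = 2` with `E/F` Galois makes `Gal(E/F)` cyclic of prime order (`IsGalois.card_aut_eq_finrank`).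

No new definition, no new named fact; the three Literature inputs enter as explicit hypotheses,
exactly as in the registered signature (they are the bundle `stub_arthurClozelDescentFacts` of the
skeleton `Cruxes/ReciprocityTRCM/Lines/pieces.lean`).
-/

set_option linter.dupNamespace false  -- every decl here lives in `Summit.Langlands.Langlands.*` (D-0017 layout)

open scoped NumberField Classical MatrixGroups
open NumberField Literature.NumberTheory.Automorphic

namespace Summit.Langlands.Langlands.Theorems.ReciprocityTRCM

/-- A Galois extension of degree `2` has cyclic Galois group (of prime order `2`). [folklore] -/
theorem isCyclic_algEquiv_of_finrank_eq_two {F E : Type} [Field F] [Field E] [Algebra F E]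
    [FiniteDimensional F E] [IsGalois F E] (h2 : Module.finrank F E = 2) :
    IsCyclic (E ≃ₐ[F] E) := by
  have hcard : Nat.card (E ≃ₐ[F] E) = 2 := by
    rw [IsGalois.card_aut_eq_finrank, h2]
  haveI : Fact (Nat.card (E ≃ₐ[F] E)).Prime := ⟨by rw [hcard]; exact Nat.prime_two⟩
  exact isCyclic_of_prime_card hcard

/-- **Registered stub `stub_quadraticDescentLAlgebraic` of line `pieces` (crux stmt-Langlands-1093):
L-algebraic quadratic descent.** For `E/F` Galois quadratic and a cuspidal L-algebraic `P` on
`GL_n(𝔸_E)` with `Gal(E/F)`-stable Satake data there is an L-algebraic cuspidal `π` on `GL_n(𝔸_F)`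
of which `P` is a weak base change lift — granted Arthur–Clozel's cyclic descent (Ch. 3 Thm. 4.2 (d),
`cuspidal_descent_cyclic`), the archimedean clause of strong lifting (Thm. 5.1,
`ArthurClozel1989_strongLifting_archimedean`) and Clozel's existence of infinity types, as hypotheses.
[cite: ArthurClozelAMS120, Ch. 3 Thm. 4.2 (d) and Thm. 5.1] [cite: Clozel1990, §3.3] -/
theorem stub_quadraticDescentLAlgebraic : Literature.NumberTheory.Automorphic.cuspidal_descent_cyclic → Literature.NumberTheory.Automorphic.ArthurClozel1989_strongLifting_archimedean → (∀ (n : ℕ) (K : Type) [Field K] [NumberField K] (hK : Literature.NumberTheory.Automorphic.isCompact_glFiniteIntegralLevel n K) (π : Literature.NumberTheory.Automorphic.AutomorphicRepData (Literature.NumberTheory.Automorphic.AutomorphyDatum.gl n K hK)), π.exists_hasInfinityType) → ∀ (n : ℕ) (F E : Type) [Field F] [NumberField F] [Field E] [NumberField E] [Algebra F E] [IsGalois F E], Module.finrank F E = 2 → ∀ (hF : Literature.NumberTheory.Automorphic.isCompact_glFiniteIntegralLevel n F) (hE : Literature.NumberTheory.Automorphic.isCompact_glFiniteIntegralLevel n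 E) (P : Literature.NumberTheory.Automorphic.CuspidalAutomorphicRepData n E hE), P.1.IsLAlgebraic → Literature.NumberTheory.Automorphic.IsGaloisStableSatakeAE F P.1 → ∃ π : Literature.NumberTheory.Automorphic.CuspidalAutomorphicRepData n F hF, π.1.IsLAlgebraic ∧ Literature.NumberTheory.Automorphic.IsWeakBaseChangeLiftAE π.1 P.1 := by
  intro hdesc harch hinf n F E _ _ _ _ _ _ h2 hF hE P hPL hstab
  haveI : FiniteDimensional F E := Module.finite_of_finrank_eq_succ h2
  have hcyc : IsCyclic (E ≃ₐ[F] E) := isCyclic_algEquiv_of_finrank_eq_two h2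
  have hprime : (Module.finrank F E).Prime := by rw [h2]; exact Nat.prime_two
  obtain ⟨π, hBC⟩ := hdesc n F E hF hE hcyc hprime P hstab
  exact ⟨π, harch.isLAlgebraic_descent' hcyc hprime hBC (hinf n F hF π.1) hPL, hBC⟩

end Summit.Langlands.Langlands.Theorems.ReciprocityTRCM
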